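import Summits.CriticalPhenomena.CardyFormulaZ2.Theorems.CardyIKTransportIKLinearTransportStubDiagramExchangePart4

/-!
# Stub `stub_DiagramExchange` (line `pinned-diagram-exchange`, crux stmt-CriticalPhenomena-5076)

Stub `stub_DiagramExchange` of the line `pinned-diagram-exchange` (crux stmt-CriticalPhenomena-5076): the finite
pinned Yang–Baxter identity `DiagramExchangeAt L` on every cylinder `ℤ/L`, `L ≥ 3`, by a "train argument" in the
coloured PARTITION category. The block is re-expressed as a cyclic necklace of local pieces (parts 2–4); a signed local
intertwiner `R` (the dilute `A₂⁽²⁾` face at spectral difference `π/6`: corner weight `-√3`, horizontal diagonal `2`,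
vertical diagonal `-1`) and its partner `R'` satisfy, AT THE LEVEL OF BOUNDARY CONNECTIVITY PARTITIONS of a
7-vertex hexagon, the Yang–Baxter relation `[D(hc,iso) below R] ≡ [R below D(iso,hc)]` and the inversion relations
`[R below R'] ≡ [R' below R] ≡ -2·[id,id]`; these finite identities are checked by the kernel in part 1 (`decide`,
weights in `ℤ√3`, reachability by a certified bit-mask closure). The separator/substitution lemma of parts 2–3 lifts
them to the necklace, cyclicity closes the train, and the bridge (parts 3–5) identifies the necklace with the block of
the vocabulary file. References: A. Morin-Duchesne, A. Klümper, P. Pearce, arXiv:2211.12379 §2.2, §3.6 (the local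
weights); the line card `Cruxes/IKLinearTransport/Lines/pinned-diagram-exchange.md`.

This final part: the bridge, weight half; the train; the registered stub `stub_DiagramExchange`.
-/

namespace Summit.CriticalPhenomena.CardyFormulaZ2.Theorems.IKLinearTransport.PinnedDiagramExchange

namespace DX

open SimpleGraph

section Bridge

variable {L : ℕ} [NeZero L]

/-! ### Weights and the configuration correspondence -/

/-- The integral face weight is four times `faceWeight`. [folklore] -/
theorem toR_fwZ (τ odd b : Bool) : toR (fwZ τ odd b) = 4 * faceWeight τ odd b := by
  have h3 : toR sq3 = Real.sqrt 3 := by simp [toR, sq3, Zsqrtd.toReal]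
  have h2 : toR 2 = 2 := map_ofNat toR 2
  have h4 : toR 4 = 4 := map_ofNat toR 4
  cases τ <;> cases odd <;> cases b <;> simp [fwZ, faceWeight, h2, h3, h4] <;> ring

/-- Products over `ZMod n` as products over `Fin n`. [folklore] -/
theorem prod_zmod {M : Type*} [CommMonoid M] : ∀ (n : ℕ) [NeZero n] (g : ZMod n → M),
    ∏ i : Fin n, g (i.val : ZMod n) = ∏ r : ZMod n, g r
  | 0, _, _ => absurd (rfl : (0 : ℕ) = 0) (NeZero.ne 0)
  | n + 1, _, g => Fintype.prod_congr _ _ fun i => congrArg g (ZMod.natCast_zmod_val (n := n + 1) i)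

/-- WEIGHT IDENTIFICATION: the start necklace weight is `16^L` times the block weight. [folklore] -/
theorem neckW_start (τ : Fin 2 → Bool) (ξ η ζ : ZMod L → Bool) (a : Fin 2 × ZMod L → Bool) :
    toR (neckW (startNeck τ) ξ ζ (ι η a)) = 16 ^ L * blockWeight L τ (colB ξ η ζ) a := by
  unfold neckW
  rw [Fin.prod_univ_add]
  have h2 : ∏ k : Fin 2, pW ξ ζ (startNeck τ (Fin.natAdd L k)) ((ι η a).1 (Fin.natAdd L k))
      ((ι η a).1 (Fin.natAdd L k + 1)) ((ι η a).2 (Fin.natAdd L k)) = 1 :=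
    Finset.prod_eq_one fun k _ => startW_I τ ξ ζ η a (by simp)
  have h1 : ∀ i : Fin L, pW ξ ζ (startNeck τ (Fin.castAdd 2 i)) ((ι η a).1 (Fin.castAdd 2 i))
      ((ι η a).1 (Fin.castAdd 2 i + 1)) ((ι η a).2 (Fin.castAdd 2 i)) =
      fwZ (τ 0) (faceOdd L (colB ξ η ζ) (0, i.val)) (a (0, i.val)) *
        fwZ (τ 1) (faceOdd L (colB ξ η ζ) (1, i.val)) (a (1, i.val)) := by
    intro i
    rw [startW_D τ ξ ζ η a (by simp)]
    simp [pieceW, faceOdd, colB]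
  rw [h2, mul_one, Finset.prod_congr rfl fun i _ => h1 i,
    prod_zmod L fun r => fwZ (τ 0) (faceOdd L (colB ξ η ζ) (0, r)) (a (0, r)) *
      fwZ (τ 1) (faceOdd L (colB ξ η ζ) (1, r)) (a (1, r)),
    map_prod]
  simp only [map_mul, toR_fwZ]
  rw [blockWeight, Fintype.prod_prod_type, Fin.prod_univ_two, ← Finset.prod_mul_distrib]
  have : ∀ r : ZMod L, 4 * faceWeight (τ 0) (faceOdd L (colB ξ η ζ) (0, r)) (a (0, r)) *
      (4 * faceWeight (τ 1) (faceOdd L (colB ξ η ζ) (1, r)) (a (1, r))) =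
      16 * (faceWeight (τ 0) (faceOdd L (colB ξ η ζ) (0, r)) (a (0, r)) *
        faceWeight (τ 1) (faceOdd L (colB ξ η ζ) (1, r)) (a (1, r))) := fun r => by ring
  simp_rw [this]
  rw [Finset.prod_mul_distrib, Finset.prod_const, Finset.card_univ, ZMod.card]

/-- SUPPORT: a necklace configuration of nonzero weight comes from a block configuration. [folklore] -/
theorem support_start (τ : Fin 2 → Bool) (ξ ζ : ZMod L → Bool) (cfg : Cfg L)
    (h : neckW (startNeck τ) ξ ζ cfg ≠ 0) :
    ∃ η : ZMod L → Bool, ∃ a : Fin 2 × ZMod L → Bool, ι η a = cfg := by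
  classical
  have hfac : ∀ i : Fin (L + 2), pW ξ ζ (startNeck τ i) (cfg.1 i) (cfg.1 (i + 1)) (cfg.2 i) ≠ 0 :=
    fun i hi => h (Finset.prod_eq_zero (Finset.mem_univ i) hi)
  have hI : ∀ i : Fin (L + 2), ¬ i.val < L → cfg.1 i = cfg.1 (i + 1) ∧ cfg.2 i = (false, false) := by
    intro i hi
    have := hfac i
    simp only [pW, startNeck, hi, ↓reduceIte, pieceW] at this
    by_contra hc
    apply this
    rw [if_neg]
    simpa [not_and_or, Bool.and_eq_true, beq_iff_eq] using hc
  have eL : (⟨L, by omega⟩ : Fin (L + 2)) + 1 = ⟨L + 1, by omega⟩ := Fin.ext (val_succ_of_lt _ (by simp))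
  have eL1 : (⟨L + 1, by omega⟩ : Fin (L + 2)) + 1 = 0 :=
    Fin.ext (by rw [Fin.val_add, Fin.val_one, Fin.val_zero]; simp)
  obtain ⟨cL, bL⟩ := hI ⟨L, by omega⟩ (lt_irrefl _)
  obtain ⟨cL1, bL1⟩ := hI ⟨L + 1, by omega⟩ (by simp)
  rw [eL] at cL
  rw [eL1] at cL1
  refine ⟨fun r => cfg.1 (pos r), fun jr => if jr.1 = 0 then (cfg.2 (pos jr.2)).1 else (cfg.2 (pos jr.2)).2, ?_⟩
  have hpos : ∀ i : Fin (L + 2), i.val < L → pos ((i.val : ZMod L)) = i := fun i hi =>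
    Fin.ext (by simp [pos, ZMod.val_cast_of_lt hi])
  have hpos0 : pos (0 : ZMod L) = 0 := Fin.ext (by simp [pos, ZMod.val_zero])
  refine Prod.ext (funext fun i => ?_) (funext fun i => ?_)
  · simp only [ι]
    by_cases hi : i.val < L
    · rw [rowOf_lt hi, hpos i hi]
    · rw [rowOf_ge hi, hpos0]
      rcases Nat.lt_or_ge i.val (L + 1) with h1 | h1
      · have : i = ⟨L, by omega⟩ := Fin.ext (by simp; omega)
        rw [this, cL, cL1]
      · have : i = ⟨L + 1, by omega⟩ := Fin.ext (by simp; omega)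
        rw [this, cL1]
  · simp only [ι]
    by_cases hi : i.val < L
    · simp [hi, hpos i hi]
    · simp only [hi, ↓reduceIte]
      rcases Nat.lt_or_ge i.val (L + 1) with h1 | h1
      · have : i = ⟨L, by omega⟩ := Fin.ext (by simp; omega)
        rw [this, bL]
      · have : i = ⟨L + 1, by omega⟩ := Fin.ext (by simp; omega)
        rw [this, bL1]

/-- `ι` is injective. [folklore] -/
theorem ι_injective : Function.Injective (fun p : (ZMod L → Bool) × (Fin 2 × ZMod L → Bool) => ι p.1 p.2) := by
  rintro ⟨η, a⟩ ⟨η', a'⟩ h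
  simp only [ι, Prod.mk.injEq] at h
  obtain ⟨h1, h2⟩ := h
  have hposr : ∀ r : ZMod L, rowOf L (pos r) = r := fun r => by rw [rowOf_lt (pos_lt r), pos_cast]
  refine Prod.ext (funext fun r => ?_) (funext fun ⟨j, r⟩ => ?_)
  · have := congrFun h1 (pos r); rwa [hposr] at this
  · have := congrFun h2 (pos r)
    simp only [pos_lt r, ↓reduceIte, pos_cast, Prod.mk.injEq] at this
    fin_cases j
    · exact this.1
    · exact this.2

/-- THE BRIDGE: pinned necklace weight of the start necklace = `16^L ×` the vocabulary's
`pinnedWeight`. [folklore] -/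
theorem bridge (hL : 3 ≤ L) (τ : Fin 2 → Bool) (ξ ζ : ZMod L → Bool)
    (Δ : Set ((Fin 2 × ZMod L) × (Fin 2 × ZMod L))) :
    pinnedN (startNeck τ) ξ ζ Δ = 16 ^ L * pinnedWeight L τ ξ ζ Δ := by
  classical
  unfold pinnedN pinnedWeight
  rw [Finset.mul_sum]
  simp_rw [Finset.mul_sum]
  rw [← Finset.sum_product', Finset.univ_product_univ]
  symm
  refine Finset.sum_bij_ne_zero (fun p _ _ => ι p.1 p.2) (fun p _ _ => Finset.mem_univ _)
    (fun p _ _ q _ _ h => ι_injective h) ?_ ?_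
  · intro cfg _ hne
    have hw : neckW (startNeck τ) ξ ζ cfg ≠ 0 := by
      intro h0; apply hne; simp [h0]
    obtain ⟨η, a, h⟩ := support_start τ ξ ζ cfg hw
    refine ⟨(η, a), Finset.mem_univ _, ?_, h⟩
    rw [← h] at hne
    rwa [diag_start hL, neckW_start, ← mul_ite_zero] at hne
  · rintro ⟨η, a⟩ _ _
    rw [diag_start hL, neckW_start, ← mul_ite_zero]
    rfl

end Bridge

/-! ## §6 The train -/

section Train

variable {L : ℕ}

/-- The `k`-th necklace of the train: `D(hc,iso)` below position `k`, the intertwiner `R` at `k`,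
`D(iso,hc)` above, and `R'` at the top position. [folklore] -/
def trainNeck (L k : ℕ) : Neck L := fun i =>
  if i.val < k then ⟨.D false true, (i.val : ZMod L)⟩
  else if i.val = k then ⟨.R, (k : ZMod L)⟩
  else if i.val ≤ L then ⟨.D true false, ((i.val - 1 : ℕ) : ZMod L)⟩
  else ⟨.R', 0⟩

/-- The necklace at the end of the train, after the second inversion. [folklore] -/
def endNeck (L : ℕ) : Neck L := fun i =>
  if i.val = 0 then ⟨.I, 0⟩ else if i.val ≤ L then ⟨.D true false, ((i.val - 1 : ℕ) : ZMod L)⟩ else ⟨.I, 0⟩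

/-- Successor of level `L`. [folklore] -/
theorem jL_succ (L : ℕ) : ((⟨L, by omega⟩ : Fin (L + 2)) + 1) = ⟨L + 1, by omega⟩ :=
  Fin.ext (val_succ_of_lt _ (by simp))

/-- Successor of level `L+1`. [folklore] -/
theorem jL1_succ (L : ℕ) : ((⟨L + 1, by omega⟩ : Fin (L + 2)) + 1) = 0 :=
  Fin.ext (by rw [Fin.val_add, Fin.val_one, Fin.val_zero]; simp)

/-- Successor of level `k ≤ L`. [folklore] -/
theorem jk_succ {L k : ℕ} (hk : k < L + 1) : ((⟨k, by omega⟩ : Fin (L + 2)) + 1) = ⟨k + 1, by omega⟩ :=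
  Fin.ext (val_succ_of_lt _ (by simpa using hk))

/-- First inversion: `-2 · [start(hc,iso)] = [train L]`. [folklore] -/
theorem step_inv1 (hL : 3 ≤ L) (ξ ζ : ZMod L → Bool) (Δ : Set ((Fin 2 × ZMod L) × (Fin 2 × ZMod L))) :
    toR (-2) * pinnedN (startNeck ![false, true]) ξ ζ Δ = toR 1 * pinnedN (trainNeck L L) ξ ζ Δ := by
  have hLL := jL_succ L
  refine window hL _ _ ξ ζ ⟨L, by omega⟩ idid rrp (-2) 1 check_inv1 ?_ ?_ ?_ ?_ ?_ ?_ ?_ ?_ Δ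
  · intro i hi
    rw [hLL] at hi
    simp only [not_or, Fin.ext_iff] at hi
    have h : i.val < L := by omega
    simp [startNeck, trainNeck, h]
  · simp [startNeck, idid]
  · rw [hLL]; simp [startNeck, idid]
  · left; rw [hLL]; simp [startNeck, idid]
  · simp [trainNeck, rrp]
  · rw [hLL]; simp [trainNeck, rrp]
  · left; rw [hLL]; simp [trainNeck, rrp]
  · simp [trainNeck, startNeck]

/-- One Yang–Baxter move: `[train (k+1)] = [train k]`. [folklore] -/
theorem step_ybe (hL : 3 ≤ L) (ξ ζ : ZMod L → Bool) (Δ : Set ((Fin 2 × ZMod L) × (Fin 2 × ZMod L)))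
    {k : ℕ} (hk : k < L) : pinnedN (trainNeck L (k + 1)) ξ ζ Δ = pinnedN (trainNeck L k) ξ ζ Δ := by
  have hkk := jk_succ (L := L) (k := k) (by omega)
  have := window hL (trainNeck L (k + 1)) (trainNeck L k) ξ ζ ⟨k, by omega⟩ ybeL ybeR 1 1 check_ybe
    ?_ ?_ ?_ ?_ ?_ ?_ ?_ ?_ Δ
  · simpa using this
  · intro i hi
    rw [hkk] at hi
    simp only [not_or, Fin.ext_iff] at hi
    unfold trainNeck
    split_ifs <;> first | rfl | (exfalso; omega)
  · simp [trainNeck, ybeL]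
  · rw [hkk]; simp [trainNeck, ybeL]
  · right; rw [hkk]; simp [trainNeck, ybeL, Nat.cast_succ]
  · simp [trainNeck, ybeR]
  · rw [hkk]; simp [trainNeck, ybeR, Nat.succ_le_of_lt hk]
  · left; rw [hkk]; simp [trainNeck, ybeR, Nat.succ_le_of_lt hk]
  · simp [trainNeck]

/-- The whole train: `[train L] = [train 0]`. [folklore] -/
theorem train (hL : 3 ≤ L) (ξ ζ : ZMod L → Bool) (Δ : Set ((Fin 2 × ZMod L) × (Fin 2 × ZMod L))) :
    ∀ k, k ≤ L → pinnedN (trainNeck L k) ξ ζ Δ = pinnedN (trainNeck L 0) ξ ζ Δ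
  | 0, _ => rfl
  | k + 1, hk => (step_ybe hL ξ ζ Δ (by omega)).trans (train hL ξ ζ Δ k (by omega))

/-- Second inversion: `[train 0] = -2 · [end]`. [folklore] -/
theorem step_inv2 (hL : 3 ≤ L) (ξ ζ : ZMod L → Bool) (Δ : Set ((Fin 2 × ZMod L) × (Fin 2 × ZMod L))) :
    toR 1 * pinnedN (trainNeck L 0) ξ ζ Δ = toR (-2) * pinnedN (endNeck L) ξ ζ Δ := by
  have hLL := jL1_succ L
  refine window hL _ _ ξ ζ ⟨L + 1, by omega⟩ rpr idid 1 (-2) check_inv2 ?_ ?_ ?_ ?_ ?_ ?_ ?_ ?_ Δ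
  · intro i hi
    rw [hLL] at hi
    simp only [not_or, Fin.ext_iff, Fin.val_zero] at hi
    have h1 : ¬ i.val < 0 := by omega
    have h2 : i.val ≠ 0 := by omega
    have h3 : i.val ≤ L := by omega
    simp [endNeck, trainNeck, h2, h3]
  · simp [trainNeck, rpr]
  · rw [hLL]; simp [trainNeck, rpr]
  · left; rw [hLL]; simp [trainNeck, rpr]
  · simp [endNeck, idid]
  · rw [hLL]; simp [endNeck, idid]
  · left; rw [hLL]; simp [endNeck, idid]
  · simp [trainNeck, endNeck]

/-- The end necklace is the rotated start necklace of the swapped column types. [folklore] -/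
theorem endNeck_rotate (L : ℕ) : (fun i => endNeck L (i + 1)) = startNeck ![true, false] := by
  funext i
  rcases Nat.lt_or_ge i.val L with h | h
  · have hv : (i + 1).val = i.val + 1 := val_succ_of_lt i (by omega)
    simp [endNeck, startNeck, hv, h, Nat.succ_le_of_lt h]
  · rcases Nat.lt_or_ge i.val (L + 1) with h1 | h1
    · have hv : (i + 1).val = i.val + 1 := val_succ_of_lt i h1
      have hiL : i.val = L := by omega
      simp [endNeck, startNeck, hv, hiL]
    · have hiv : i.val = L + 1 := by omega
      have hv : i + 1 = 0 := Fin.ext (by rw [Fin.val_add, Fin.val_one, Fin.val_zero, hiv]; simp)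
      simp [endNeck, startNeck, hv, hiv]

/-- THE PINNED DIAGRAM EXCHANGE for `L ≥ 3`. [folklore] -/
theorem exchange (hL : 3 ≤ L) [NeZero L] (ξ ζ : ZMod L → Bool)
    (Δ : Set ((Fin 2 × ZMod L) × (Fin 2 × ZMod L))) :
    pinnedWeight L ![false, true] ξ ζ Δ = pinnedWeight L ![true, false] ξ ζ Δ := by
  have h1 := step_inv1 hL ξ ζ Δ
  have h2 := train hL ξ ζ Δ L le_rfl
  have h3 := step_inv2 hL ξ ζ Δ
  have h4 : pinnedN (endNeck L) ξ ζ Δ = pinnedN (startNeck ![true, false]) ξ ζ Δ := by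
    rw [← pinnedN_rotate (endNeck L), endNeck_rotate]
  rw [bridge hL] at h1
  rw [h4, bridge hL] at h3
  have hm2 : toR (-2) = -2 := by rw [map_neg, map_ofNat]
  rw [map_one, one_mul] at h1 h3
  rw [hm2] at h1 h3
  have h16 : (16 : ℝ) ^ L ≠ 0 := pow_ne_zero _ (by norm_num)
  have key : (-2) * (16 ^ L * pinnedWeight L ![false, true] ξ ζ Δ) =
      (-2) * (16 ^ L * pinnedWeight L ![true, false] ξ ζ Δ) := by rw [h1, h2, h3]
  have := mul_left_cancel₀ (by norm_num : (-2 : ℝ) ≠ 0) key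
  exact mul_left_cancel₀ h16 this

end Train

end DX

/-- STUB `stub_DiagramExchange` of the line `pinned-diagram-exchange` (crux stmt-CriticalPhenomena-5076):
the finite pinned Yang–Baxter identity `DiagramExchangeAt L` holds on every cylinder `ℤ/L`, `L ≥ 3`.
Proof: train argument in the coloured partition category with the kernel-checked partition-level
Yang–Baxter and inversion relations of the signed intertwiner (`DX.check_ybe`, `DX.check_inv1`,
`DX.check_inv2`), the separator/substitution lemma `DX.window`, cyclicity `DX.pinnedN_rotate`, and
the identification `DX.bridge` of the vocabulary's block with the start necklace. [folklore] -/
theorem stub_DiagramExchange : ∀ (L : ℕ) [NeZero L], 3 ≤ L → DiagramExchangeAt L :=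
  fun _ _ hL ξ ζ Δ => DX.exchange hL ξ ζ Δ

end Summit.CriticalPhenomena.CardyFormulaZ2.Theorems.IKLinearTransport.PinnedDiagramExchange
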